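import Literature.AlgebraicGeometry.Resolution.AlterationsSectionDivisor
import Literature.AlgebraicGeometry.Resolution.FlatSlicingCriterion
import Mathlib.AlgebraicGeometry.AlgClosed.Basic
import Mathlib.AlgebraicGeometry.Morphisms.QuasiFinite
import Mathlib.RingTheory.Unramified.LocalRing
import HarnessLib

/-!
# Stalk-level flatness and unramifiedness for a sliced subscheme (inputs of de Jong 1996, proof of 4.13)

Topic: `Literature/AlgebraicGeometry/Resolution`. Generic lemmas, all PROVED, feeding the proof
of the named fact `DeJong1996MultisectionEtaleNhd` (`AlterationsMultisectionEtaleNhdProofs.lean`):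
"At each of the intersection points `x ∈ f⁻¹(y) ∩ H` […] `f` is smooth at `x`. Further `H` is
defined by `(h) ⊂ 𝒪_{X,x}` with `h̄ ∉ 𝔪²`, as `H ∩ f⁻¹(y)` [is reduced]. Therefore `f|_H : H → Y`
is finite étale over a neighbourhood of `y`" (de Jong 1996, p. 70).

* Points, stalks, fibres: `flat_stalkMap_of_mem_smoothLocus` (`f` is flat at its smooth
  points), `isAlgClosed_residueField_of_isClosed` (closed points over an algebraically closed
  field), `isClosed_singleton_of_apply_eq` (points over a closed point of a quasi-finite morphism
  are closed), `isField_stalk_of_discreteTopology` (local rings of a reduced discrete scheme are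
  fields), `one_le_ringKrullDim_stalk_of_mem_irreducibleComponents` (`dim 𝒪_{F,x} ≥ 1` at a
  closed point of a one-dimensional component).
* Local algebra: `mem_nonZeroDivisors_of_maximalIdeal_eq_span` (a principal maximal ideal of a
  Noetherian local ring of positive dimension is generated by a non-zero-divisor — Krull's
  intersection theorem), `quotient_mk_mem_nonZeroDivisors_of_isField` (for `π : B ↠ C` with
  kernel `(h)` and `C/𝔪C` a field, `dim B/𝔪 ≥ 1`, the image of `h` in `B/𝔪` is a
  non-zero-divisor: "`h̄ ∉ 𝔪²`" in de Jong's words).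
* Stalk maps: `formallyUnramified_stalkMap_of_isField` (EGA IV₄ 17.4.1/17.6.1 c′): `𝔪_y𝒪_z`
  maximal and `κ(z)/κ(y)` separable ⇒ `𝒪_y → 𝒪_z` formally unramified, Mathlib
  `Algebra.FormallyUnramified.of_map_maximalIdeal`), `flat_stalkMap_subschemeι_comp` (EGA IV₃
  11.3.8: `𝒪_{X,x}` flat over `𝒪_{Y,y}` and `h̄` a non-zero-divisor of `𝒪_{X,x}/𝔪_y𝒪_{X,x}` ⇒
  `𝒪_{V(I),z} = 𝒪_{X,x}/(h)` flat, by Matsumura's Corollary to Thm. 22.5 proved in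
  `FlatSlicingCriterion.lean`, `Matsumura1987.isSMulRegular_and_flat_quotient_of_isSMulRegular_fiber`,
  and the description of the stalks of a closed subscheme, `stalkIdeal_ker_eq_ker_stalkMap`).

## Sources

* A. J. de Jong, *Smoothness, semi-stability and alterations*, Publ. Math. IHÉS 83 (1996),
  Lemma 4.13 (proof), p. 70. [DeJong1996]
* A. Grothendieck, J. Dieudonné, *EGA IV₃*, Publ. Math. IHÉS 28 (1966), Thm. 11.3.8. [EGAIV3]
* A. Grothendieck, J. Dieudonné, *EGA IV₄*, Publ. Math. IHÉS 32 (1967), Thm. 17.6.1.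
  [Grothendieck1967]
* H. Matsumura, *Commutative Ring Theory* (1986), §22, Corollary to Thm. 22.5. [Matsumura1987]
-/

noncomputable section

open CategoryTheory CategoryTheory.Limits AlgebraicGeometry TopologicalSpace Topology IsLocalRing

namespace Literature.AlgebraicGeometry.Resolution

universe u

/-! ## Generic lemmas on points, stalks and fibres -/

/-- **`f` is flat at the points of its smooth locus**: on the open `U = sm(X/Y)` the restriction
`U → Y` is smooth (Mathlib `Scheme.Hom.smoothLocus_eq_top_iff`), hence flat, and its stalk maps
are those of `f`. [folklore] -/
theorem flat_stalkMap_of_mem_smoothLocus {X Y : Scheme.{u}} (f : X ⟶ Y)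
    [LocallyOfFinitePresentation f] {x : X} (hx : x ∈ f.smoothLocus) :
    (f.stalkMap x).hom.Flat := by
  set U : X.Opens := f.smoothLocus with hU
  haveI hsm : Smooth (U.ι ≫ f) := by
    rw [← Scheme.Hom.smoothLocus_eq_top_iff, ← Scheme.Hom.preimage_smoothLocus_eq]
    exact Scheme.Opens.ι_preimage_self U
  have h := Flat.stalkMap (U.ι ≫ f) (⟨x, hx⟩ : U.toScheme)
  rw [Scheme.Hom.stalkMap_comp] at h
  have h' : ((U.ι.stalkMap (⟨x, hx⟩ : U.toScheme)).hom.comp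
      (f.stalkMap (U.ι (⟨x, hx⟩ : U.toScheme))).hom).Flat := h
  rwa [RingHom.Flat.comp_iff_of_bijective_left (ConcreteCategory.bijective_of_isIso _)] at h'

/-- The residue field of a closed point of a scheme locally of finite type over an algebraically
closed field `k` is algebraically closed (it is `k`, Mathlib `residueFieldIsoBase`). [folklore] -/
theorem isAlgClosed_residueField_of_isClosed {Y : Scheme.{u}} {k : Type u} [Field k]
    [IsAlgClosed k] (g : Y ⟶ Spec (.of k)) [LocallyOfFiniteType g] {y : Y}
    (hy : IsClosed ({y} : Set Y)) : IsAlgClosed (Y.residueField y) :=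
  IsAlgClosed.of_ringEquiv k _ (residueFieldIsoBase g y hy).commRingCatIsoToRingEquiv.symm

/-- **Points over a closed point under a locally quasi-finite morphism are closed**: the closure
of such a point `z` lies in the fibre, which is discrete (Mathlib
`Scheme.Hom.isDiscrete_preimage_singleton`), so it is `{z}`. [folklore] -/
theorem isClosed_singleton_of_apply_eq {H Y : Scheme.{u}} (g : H ⟶ Y) [LocallyQuasiFinite g]
    {y : Y} (hy : IsClosed ({y} : Set Y)) {z : H} (hz : g z = y) :
    IsClosed ({z} : Set H) := by
  rw [← closure_subset_iff_isClosed]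
  intro w hw
  have hzw : z ⤳ w := specializes_iff_mem_closure.mpr hw
  have hw' : g w = y := by
    have hmem : g w ∈ closure {g z} := specializes_iff_mem_closure.mp (hzw.map g.continuous)
    rwa [hz, hy.closure_eq, Set.mem_singleton_iff] at hmem
  have hS := g.isDiscrete_preimage_singleton y
  rw [isDiscrete_iff_discreteTopology] at hS
  have h : (⟨z, hz⟩ : g ⁻¹' {y}) ⤳ ⟨w, hw'⟩ := by
    rw [subtype_specializes_iff]
    exact hzw
  have := h.eq
  simp only [Subtype.mk.injEq] at this
  rw [this]
  exact Set.mem_singleton _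

/-- **The local rings of a reduced discrete scheme are fields** (e.g. a reduced fibre of a
quasi-finite morphism): such a local ring has dimension `0` (no point generises `z` properly,
Mathlib `ringKrullDim_stalk_eq_coheight`), so its maximal ideal is its nilradical, which is `0`.
[folklore] -/
theorem isField_stalk_of_discreteTopology {F : Scheme.{u}} [DiscreteTopology F] [IsReduced F]
    (z : F) : IsField (F.presheaf.stalk z) := by
  have hdim : ringKrullDim (F.presheaf.stalk z) = 0 := by
    rw [ringKrullDim_stalk_eq_coheight z]
    have : Order.coheight z = 0 := by
      rw [Order.coheight_eq_zero]
      intro b hb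
      have hbz : b ⤳ z := Scheme.le_iff_specializes.mp hb
      rw [hbz.eq]
    rw [this]
    rfl
  haveI : Ring.KrullDimLE 0 (F.presheaf.stalk z) := by
    rw [Ring.krullDimLE_iff, hdim]; rfl
  rw [IsLocalRing.isField_iff_maximalIdeal_eq]
  have hnil : nilradical (F.presheaf.stalk z) = maximalIdeal _ := by
    rw [nilradical_eq_sInf]
    apply le_antisymm
    · exact sInf_le (show maximalIdeal _ ∈ {J : Ideal _ | J.IsPrime} from
        (inferInstance : (maximalIdeal _).IsMaximal).isPrime)
    · refine le_sInf ?_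
      rintro p (hp : p.IsPrime)
      exact (IsLocalRing.eq_maximalIdeal hp.isMaximal').ge
  rw [← hnil, nilradical_eq_zero]
  rfl

/-- **`dim 𝒪_{F,x} ≥ 1` at a closed point `x` of an irreducible component of dimension `1`**: the
generic point of the component is a proper generisation of `x` (a component equal to `{x}` would
have dimension `0`), and `dim 𝒪_{F,x}` is the coheight of `x` in the specialisation order
(Mathlib `ringKrullDim_stalk_eq_coheight`). [folklore] -/
theorem one_le_ringKrullDim_stalk_of_mem_irreducibleComponents {F : Scheme.{u}} {x : F}
    (hx : IsClosed ({x} : Set F)) {C : Set F} (hC : C ∈ irreducibleComponents F) (hxC : x ∈ C)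
    (hC1 : topologicalKrullDim C = 1) : 1 ≤ ringKrullDim (F.presheaf.stalk x) := by
  rw [ringKrullDim_stalk_eq_coheight x]
  have hCcl : IsClosed C := isClosed_of_mem_irreducibleComponents C hC
  -- the generic point of `C`
  obtain ⟨η, hη⟩ := QuasiSober.sober hC.1 hCcl
  have hηx : η ⤳ x := hη.specializes hxC
  have hne : η ≠ x := by
    rintro rfl
    have hCx : C = {η} := by rw [← hη.def, hx.closure_eq]
    have h0 : topologicalKrullDim C ≤ 0 := by
      subst hCx
      exact topologicalKrullDim_zero_of_discreteTopology _
    rw [hC1] at h0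
    exact absurd h0 (by norm_num)
  have hlt : x < η := by
    refine lt_iff_le_not_ge.mpr ⟨Scheme.le_iff_specializes.mpr hηx, fun hle => hne ?_⟩
    have hxη : x ⤳ η := Scheme.le_iff_specializes.mp hle
    have hmem : η ∈ closure {x} := specializes_iff_mem_closure.mp hxη
    rw [hx.closure_eq, Set.mem_singleton_iff] at hmem
    exact hmem
  have h1 : (1 : ℕ∞) ≤ Order.coheight x := by
    rw [Order.one_le_iff_ne_zero, Order.coheight_ne_zero]
    exact not_isMax_of_lt hlt
  exact_mod_cast h1


/-! ## Local algebra -/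

/-- In a Noetherian local ring of dimension `≥ 1` whose maximal ideal is principal, `𝔪 = (h)`,
the generator `h` is a non-zero-divisor: if `bh = 0` with `b ≠ 0`, Krull's intersection theorem
gives `b = u hᵏ` with `u` a unit, so `hᵏ⁺¹ = 0`, `𝔪` is nilpotent and every prime is `𝔪`,
contradicting `dim ≥ 1`. [folklore] -/
theorem mem_nonZeroDivisors_of_maximalIdeal_eq_span {R : Type*} [CommRing R] [IsLocalRing R]
    [IsNoetherianRing R] {h : R} (hm : maximalIdeal R = Ideal.span {h})
    (hdim : 1 ≤ ringKrullDim R) : h ∈ nonZeroDivisors R := by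
  rw [mem_nonZeroDivisors_iff_right]
  intro b hb
  by_contra hb0
  -- Krull's intersection theorem: `b ∈ 𝔪ᵏ ∖ 𝔪ᵏ⁺¹` for some `k`
  have hKrull : ⨅ i : ℕ, maximalIdeal R ^ i = ⊥ :=
    Ideal.iInf_pow_eq_bot_of_isLocalRing _ (maximalIdeal.isMaximal R).ne_top
  have hex : ∃ i : ℕ, b ∉ maximalIdeal R ^ i := by
    by_contra hall
    push Not at hall
    apply hb0
    have : b ∈ ⨅ i : ℕ, maximalIdeal R ^ i := Ideal.mem_iInf.mpr hall
    rwa [hKrull, Ideal.mem_bot] at this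
  classical
  have hn0 : Nat.find hex ≠ 0 := by
    intro h0
    have := Nat.find_spec hex
    rw [h0, pow_zero, Ideal.one_eq_top] at this
    exact this trivial
  obtain ⟨k, hk⟩ := Nat.exists_eq_succ_of_ne_zero hn0
  have hbk : b ∈ maximalIdeal R ^ k := by
    by_contra hnot
    exact Nat.find_min hex (show k < Nat.find hex by omega) hnot
  have hbk1 : b ∉ maximalIdeal R ^ (k + 1) := by
    rw [← Nat.succ_eq_add_one, ← hk]
    exact Nat.find_spec hex
  rw [hm, Ideal.span_singleton_pow, Ideal.mem_span_singleton'] at hbk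
  obtain ⟨c, rfl⟩ := hbk
  have hc : IsUnit c := by
    by_contra hcu
    have hcm : c ∈ maximalIdeal R := (mem_maximalIdeal c).mpr (mem_nonunits_iff.mpr hcu)
    rw [hm, Ideal.mem_span_singleton'] at hcm
    obtain ⟨d, rfl⟩ := hcm
    apply hbk1
    rw [hm, Ideal.span_singleton_pow, Ideal.mem_span_singleton']
    exact ⟨d, by ring⟩
  -- `hᵏ⁺¹ = 0`
  have hhn : h ^ (k + 1) = 0 := by
    have : c * h ^ (k + 1) = 0 := by rw [pow_succ, ← mul_assoc]; exact hb
    exact (hc.mul_right_eq_zero).mp this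
  -- so every prime is `𝔪` and `dim R ≤ 0`
  have hle : ringKrullDim R ≤ 0 := by
    rw [← Nat.cast_zero, ← Ring.krullDimLE_iff]
    refine Ring.KrullDimLE.mk₀ fun p hp => ?_
    have hhp : h ∈ p := hp.mem_of_pow_mem (k + 1) (by rw [hhn]; exact p.zero_mem)
    have hmp : maximalIdeal R ≤ p := by
      rw [hm, Ideal.span_le, Set.singleton_subset_iff]
      exact hhp
    rw [(IsLocalRing.le_maximalIdeal hp.ne_top).antisymm hmp]
    exact maximalIdeal.isMaximal R
  have h10 : (1 : WithBot ℕ∞) ≤ 0 := hdim.trans hle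
  exact absurd h10 (by decide)

/-- **The fibrewise regularity of a local equation, from the reducedness of the fibre.** Let
`(B, 𝔫)` be a Noetherian local ring, `𝔪 ⊆ B` an ideal (the extension of the maximal ideal of a
base local ring) with `dim B/𝔪 ≥ 1`, and `π : B → C` a surjection with kernel `(h)` such that
`C/𝔪C` is a field. Then the image `h̄` of `h` in `B/𝔪` is a non-zero-divisor: `𝔪 + (h)` is the
maximal ideal of `B`, so the maximal ideal of the local ring `B/𝔪` is `(h̄)`, and
`mem_nonZeroDivisors_of_maximalIdeal_eq_span` applies. (For de Jong 1996, 4.13: `B = 𝒪_{X,x}`,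
`C = 𝒪_{H,x}`, `B/𝔪 = 𝒪_{X_y,x}` one-dimensional, `C/𝔪C = 𝒪_{H_y,x}` a field as `H ∩ f⁻¹(y)` is
finite and reduced: "`H` is defined by `(h) ⊂ 𝒪_{X,x}` with `h̄ ∉ 𝔪²`".) [folklore] -/
theorem quotient_mk_mem_nonZeroDivisors_of_isField {B C : Type*} [CommRing B] [CommRing C]
    [IsLocalRing B] [IsNoetherianRing B] (m : Ideal B) (π : B →+* C)
    (hπ : Function.Surjective π) {h : B} (hker : RingHom.ker π = Ideal.span {h})
    (hfield : IsField (C ⧸ m.map π)) (hdim : 1 ≤ ringKrullDim (B ⧸ m)) :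
    Ideal.Quotient.mk m h ∈ nonZeroDivisors (B ⧸ m) := by
  -- `𝔪 ⊔ (h)` is the maximal ideal of `B`
  have hP : (m.map π).comap π = m ⊔ Ideal.span {h} := by
    rw [Ideal.comap_map_of_surjective π hπ, ← RingHom.ker_eq_comap_bot, hker]
  haveI hPmax : ((m.map π).comap π).IsMaximal :=
    Ideal.comap_isMaximal_of_surjective π hπ
      (K := m.map π) (H := Ideal.Quotient.maximal_of_isField _ hfield)
  have hmax : maximalIdeal B = m ⊔ Ideal.span {h} :=
    hP ▸ (IsLocalRing.eq_maximalIdeal hPmax).symm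
  -- `B/𝔪` is a Noetherian local ring with maximal ideal `(h̄)`
  have hm_ne : m ≠ ⊤ := by
    intro hmt
    rw [hmt] at hdim
    haveI : Subsingleton (B ⧸ (⊤ : Ideal B)) := Ideal.Quotient.subsingleton_iff.mpr rfl
    rw [ringKrullDim_eq_bot_of_subsingleton] at hdim
    exact absurd hdim (by decide)
  haveI : Nontrivial (B ⧸ m) := Ideal.Quotient.nontrivial_iff.mpr hm_ne
  haveI : IsLocalRing (B ⧸ m) := IsLocalRing.of_surjective' _ Ideal.Quotient.mk_surjective
  have hmax' : maximalIdeal (B ⧸ m) = Ideal.span {Ideal.Quotient.mk m h} := by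
    symm
    apply IsLocalRing.eq_maximalIdeal
    rw [Ideal.Quotient.maximal_ideal_iff_isField_quotient]
    have e1 : (Ideal.span {h}).map (Ideal.Quotient.mk m) = Ideal.span {Ideal.Quotient.mk m h} := by
      rw [Ideal.map_span, Set.image_singleton]
    have hF : IsField (B ⧸ (m ⊔ Ideal.span {h})) := by
      rw [← hmax]
      exact (Ideal.Quotient.maximal_ideal_iff_isField_quotient _).mp inferInstance
    exact MulEquiv.isField hF
      ((Ideal.quotEquivOfEq e1.symm).trans
        (DoubleQuot.quotQuotEquivQuotSup m (Ideal.span {h}))).toMulEquiv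
  exact mem_nonZeroDivisors_of_maximalIdeal_eq_span hmax' hdim


/-! ## Stalk-level criteria -/

/-- **Unramified at a point, read on the fibre** (EGA IV₄ 17.6.1 c′)⇒c) / 17.4.1): for
`g : H → Y` locally of finite type and `z ∈ H`, if `𝒪_{H,z}/𝔪_{g z}𝒪_{H,z}` is a field and
`κ(z)/κ(g z)` is separable, then the stalk map `𝒪_{Y,g z} → 𝒪_{H,z}` is formally unramified
(Mathlib `Algebra.FormallyUnramified.of_map_maximalIdeal`: `𝔪_{g z}𝒪_{H,z} = 𝔪_z`).
[cite: Grothendieck1967, Thm. 17.6.1 c′)⇒c)] -/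
theorem formallyUnramified_stalkMap_of_isField {H Y : Scheme.{u}} (g : H ⟶ Y)
    [LocallyOfFiniteType g] (z : H)
    (hF : IsField (H.presheaf.stalk z ⧸
      (maximalIdeal (Y.presheaf.stalk (g z))).map (g.stalkMap z).hom))
    (hsep : letI : Algebra (Y.residueField (g z)) (H.residueField z) :=
        (g.residueFieldMap z).hom.toAlgebra
      Algebra.IsSeparable (Y.residueField (g z)) (H.residueField z)) :
    (g.stalkMap z).hom.FormallyUnramified := by
  algebraize [(g.stalkMap z).hom]
  haveI : IsLocalHom (algebraMap (Y.presheaf.stalk (g z)) (H.presheaf.stalk z)) :=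
    inferInstanceAs <| IsLocalHom (g.stalkMap z).hom
  haveI : Algebra.EssFiniteType (Y.presheaf.stalk (g z)) (H.presheaf.stalk z) := by
    rw [← RingHom.essFiniteType_algebraMap, RingHom.algebraMap_toAlgebra]
    exact LocallyOfFiniteType.stalkMap g z
  haveI : Algebra.IsSeparable (ResidueField (Y.presheaf.stalk (g z)))
      (ResidueField (H.presheaf.stalk z)) := by
    convert! hsep
    refine Algebra.algebra_ext _ _ fun r ↦ ?_
    obtain ⟨r, rfl⟩ := IsLocalRing.residue_surjective r
    rfl
  have hmax : (maximalIdeal (Y.presheaf.stalk (g z))).map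
      (algebraMap (Y.presheaf.stalk (g z)) (H.presheaf.stalk z)) = maximalIdeal _ :=
    IsLocalRing.eq_maximalIdeal ((Ideal.Quotient.maximal_ideal_iff_isField_quotient _).mpr hF)
  have := Algebra.FormallyUnramified.of_map_maximalIdeal hmax
  rwa [← RingHom.formallyUnramified_algebraMap, RingHom.algebraMap_toAlgebra] at this

/-- **Flatness of `f|_H` at a point of `H = V(I)` by slicing** (de Jong 1996, proof of 4.13,
via Matsumura, Cor. to Thm. 22.5 = EGA IV₃ 11.3.8): let `f : X → Y` be a morphism of locally
Noetherian schemes, `I` an ideal sheaf on `X`, `z ∈ H = V(I)` with image `x ∈ X`. If `𝒪_{X,x}`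
is flat over `𝒪_{Y,f x}` and `I_x = (h)` with `h̄` a non-zero-divisor of
`𝒪_{X,x}/𝔪_{f x}𝒪_{X,x}`, then `𝒪_{H,z} = 𝒪_{X,x}/(h)` is flat over `𝒪_{Y,f x}`, i.e. the stalk map
of `f|_H = ι_H ≫ f` at `z` is flat. [cite: EGAIV3, Thm. 11.3.8 c)⇒b)] -/
theorem flat_stalkMap_subschemeι_comp {X Y : Scheme.{u}} (f : X ⟶ Y) [IsLocallyNoetherian X]
    [IsLocallyNoetherian Y] (I : X.IdealSheafData) (z : ↥I.subscheme)
    (hfl : (f.stalkMap (I.subschemeι z)).hom.Flat) {h : X.presheaf.stalk (I.subschemeι z)}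
    (hI : stalkIdeal I (I.subschemeι z) = Ideal.span {h})
    (hreg : Ideal.Quotient.mk ((maximalIdeal (Y.presheaf.stalk (f (I.subschemeι z)))).map
      (f.stalkMap (I.subschemeι z)).hom) h ∈ nonZeroDivisors _) :
    ((I.subschemeι ≫ f).stalkMap z).hom.Flat := by
  -- `π = ι^♯_z` is surjective with kernel `I_x = (h)`
  have hπ : Function.Surjective (I.subschemeι.stalkMap z).hom := I.subschemeι.stalkMap_surjective z
  have hker : RingHom.ker (I.subschemeι.stalkMap z).hom = Ideal.span {h} := by
    rw [← hI, ← stalkIdeal_ker_eq_ker_stalkMap I.subschemeι z,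
      Scheme.IdealSheafData.ker_subschemeι]
  have hψ : ((I.subschemeι ≫ f).stalkMap z).hom =
      (I.subschemeι.stalkMap z).hom.comp (f.stalkMap (I.subschemeι z)).hom := by
    rw [Scheme.Hom.stalkMap_comp]
    rfl
  -- the slicing criterion for `𝒪_{Y,f x} → 𝒪_{X,x}` and `h`
  algebraize [(f.stalkMap (I.subschemeι z)).hom]
  haveI : IsLocalHom (algebraMap (Y.presheaf.stalk (f (I.subschemeι z)))
      (X.presheaf.stalk (I.subschemeι z))) :=
    inferInstanceAs <| IsLocalHom (f.stalkMap (I.subschemeι z)).hom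
  have hx' : IsSMulRegular (X.presheaf.stalk (I.subschemeι z) ⧸
      (maximalIdeal (Y.presheaf.stalk (f (I.subschemeι z)))).map
        (algebraMap _ (X.presheaf.stalk (I.subschemeι z)))) h := by
    rw [Matsumura1987.isSMulRegular_quotient_iff]
    intro b hb
    have h0 : Ideal.Quotient.mk _ b * Ideal.Quotient.mk ((maximalIdeal
        (Y.presheaf.stalk (f (I.subschemeι z)))).map (algebraMap _ _)) h = 0 := by
      rw [← map_mul, Ideal.Quotient.eq_zero_iff_mem, mul_comm]
      exact hb
    exact Ideal.Quotient.eq_zero_iff_mem.mp (mem_nonZeroDivisors_iff_right.mp hreg _ h0)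
  have hflat : Module.Flat (Y.presheaf.stalk (f (I.subschemeι z)))
      (X.presheaf.stalk (I.subschemeι z) ⧸ Ideal.span {h}) :=
    (Matsumura1987.isSMulRegular_and_flat_quotient_of_isSMulRegular_fiber hx').2
  -- transport along `𝒪_{X,x}/(h) ≅ 𝒪_{H,z}`
  letI : Algebra (Y.presheaf.stalk (f (I.subschemeι z))) (I.subscheme.presheaf.stalk z) :=
    ((I.subschemeι.stalkMap z).hom.comp (f.stalkMap (I.subschemeι z)).hom).toAlgebra
  let πₐ : X.presheaf.stalk (I.subschemeι z) →ₐ[Y.presheaf.stalk (f (I.subschemeι z))]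
      I.subscheme.presheaf.stalk z :=
    { (I.subschemeι.stalkMap z).hom with commutes' := fun a => rfl }
  have hπₐ : Function.Surjective πₐ := hπ
  have hkerₐ : RingHom.ker πₐ.toRingHom = Ideal.span {h} := hker
  let e : (X.presheaf.stalk (I.subschemeι z) ⧸ Ideal.span {h}) ≃ₐ[Y.presheaf.stalk
      (f (I.subschemeι z))] I.subscheme.presheaf.stalk z :=
    (Ideal.quotientEquivAlgOfEq _ hkerₐ.symm).trans (Ideal.quotientKerAlgEquivOfSurjective hπₐ)
  have hC : Module.Flat (Y.presheaf.stalk (f (I.subschemeι z))) (I.subscheme.presheaf.stalk z) :=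
    Module.Flat.of_linearEquiv e.symm.toLinearEquiv
  rw [hψ]
  exact hC

end Literature.AlgebraicGeometry.Resolution

end
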